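import Summits.QuantumFields.YangMills.Theorems.UnitScaleTiltHalvingHSupURho3OfSiteRows
import HarnessLib

/-!
# Route `UnitScaleTilt`, crux K1 child «MinimiserStabilityRegPr» (stmt-QuantumFields-19200), registered stub `stub_halvingStep` (v10 `BirthV10`) —
# **LEAD-H (K-final, prefix layer v2): «H = hSupUρ3» FROM THE PER-MEMBER COMPOSER TEXT `hMemberL`** — ✓p657837 `hSupUρ3_of_memberRows` with TWO REPAIRS:
# (i) the constants `M′ B₀ Cw Mₚ` are chosen PER `L` (the window hand's constant carries `L¹²` and the [4] letters depend on `L`), (ii) the member letters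
# `a Cr ε₁` with `0 < Cr`, `12(ρ+M)·a ≤ Cr`, `0 < ε₁`, `ε₀ ≤ a`, `Cr·ε₁ ≤ ε₀`, `PlaqSmall ε₁ V` that ✓p653138 `hSiteRows` carries are RESTORED at the composer level
# (the top-level (1.42) row (h2) needs `PlaqSmall ε₁ V` through ✓`P1FlatCoreDP1TopBonds.norm_mlog_dbarIterU_chart_le_of_top`)

Cell `ym3-torus` (HUMAN RULING D-0037, YM ladder rung R3 — YM₃ on T³ is a RUNG, NOT the Clay problem), width seat `ym-ust-19200-w5` gen 5 (LEAD-H g5).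
`--supports stmt-QuantumFields-19200 --as helper`; count-neutral; def-free, 0 sorry, standard axioms.  `hMemberL` is a HYPOTHESIS (the conclusion shape of the
per-site composers ✓`HalvingHSiteRowsOfSocketsBase.siteRows_of_sockets_base` (k = 1) ∕ `siteRows_of_sockets` (k ≥ 2), whose own displayed hypotheses are the
N05∕N06 sockets); nothing here claims the stub, the crux, the rung or the gap.

WHAT.  `hMemberL` := for every odd `L > 1` THERE ARE `M′ ≥ 1`, `B₀ ≥ 0`, `Cw > 0`, `Mₚ` such that for all route data `(ρ, S, M)` with `Mₚ ≤ M`, `2 ≤ S`, all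
`a Cr` with `0 < Cr`, `12(ρ+M)a ≤ Cr`, all `ε₀ ε₁ > 0` with `ε₀ ≤ a`, `Cr·ε₁ ≤ ε₀`, the WINDOW SMALLNESS `Cw·((ρ′+M′+1)³·ε₀) ≤ 1` (✓`HalvingHSupURhoWindowsRho3.
exists_topCall_constants_of_rhoWindow₃`'s letter at `ρ′ := ρ+M+L+S`) and every size letter `Bsz ≥ (2985·L·B₀+405)·(ρ′+M′+1)` (≥ `cstar∕ε₀` of the window schedule),
every member with room, every `V` with `PlaqSmall ε₁ V`, every `U ∈ regFibrePr … ε₀ V`, site `x₀`: the ∃-BODY of ✓p653138's `hSiteRows` with its two [R-h] size rows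
read `≤ Bsz·ε₀`.  ★★★ `hSupUρ3_of_memberRowsL (hMemberL) : <hSupUρ3 VERBATIM>` through ✓`hSupUρ3_of_siteRows`, choices as in ✓p657837: `Rₚ := 2`, `qρ := 3`,
`B₁ := (2985·L·B₀ + 405)·(M+L+S+M′+1)`, `Cρ := Cw·(M+L+S+M′+1)³`, `Bsz := B₁·(ρ+1)³`.
INHABITABILITY (OWNER №9 (3)): `hMemberL` is WEAKER than ✓p657837's `hMember` (more antecedents, constants per `L`), hence inhabited whenever `hMember` is; the
choices are ρ-free as the prefix demands; `ρ′+M′+1 ≤ (ρ+1)·(M+L+S+M′+1)` turns `Cρ(ρ+1)³a ≤ 1` + `ε₀ ≤ a` into `hw` and `ρ+1 ≤ (ρ+1)³` gives `hBsz`.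
References: T. Bałaban, CMP **99** (1985) 75–102 [Balaban1985RegularSpaces] Thm 2 p.83, (1.33)–(1.38) p.82, (1.42) p.83; CMP **102** (1985) 277–309
[Balaban1985Variational] (144) p.300, (150)–(156) pp.301–302.
-/

set_option autoImplicit false

noncomputable section

open scoped BigOperators Matrix.Norms.L2Operator
open NormedSpace
open Complex (I)

namespace Summit.QuantumFields.YangMills.Theorems.HalvingHSupURho3OfMemberRowsL

open Literature.MathematicalPhysics.QuantumFieldTheory.Balaban1983to89
open Literature.MathematicalPhysics.QuantumFieldTheory.Balaban1983to89.T3ContinuumYM3Torus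
open Literature.MathematicalPhysics.QuantumFieldTheory.Balaban1983to89.T3PrintedRegularMinimiser
open MatrixLog (mlog)
open B5Eq118OneStroke (iterBlockOf)
open B6SectAOperatorsV1 (SiteIdx)
open B7Prop1Explicit renaming Site → LSite
open B7Prop1Explicit (e)
open B7Prop2Explicit (unitaryUnits)
open B7Eq78Linearization (conjR)
open B7Eq92Concrete (mgauge)
open B8Ineq132 (covDerivFwd)
open B8Eq131Cubes (cube gs)
open B8Eq131CubesAdmissible (cubeFam)
open B8Eq138LandauZd (covDivB covLap QT IsLandau138W logCfg)
open B8Eq140Level (SideTouches)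
open B8Eq182Proof (gAd)
open B8Eq184Proof (gaugeExp cfgExp)
open B8Eq188Proof (frakF3)
open B8LambdaSpaceKLevel (wt)
open B8CubeMemberZd (cubeLamS)
open B10Eq27TorusAxialLog (transl rel pull unitsField toUField suIncl gaugeActT axialT)
open B15Eq112TorusCover (lift)
open Node00 (coverAt)
open LatticeFieldCalculus (laplace diverg siteAvgIter)
open FlatCubeOpsText (IsLevWeight)
open FlatCubeSequenceAligned (cubeSeqMT3 cubeSetM)
open Summit.QuantumFields.YangMills.Theorems.Prop8ChartDoubleBar (dbarIterU vframeU)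
open HalvingP1FlatPillar (DP1Clause)
open HalvingHSupURho3OfSiteRows (hSupUρ3_of_siteRows)

open Classical in
/-- ★★★ **(K-final, prefix layer v2) «H = hSupUρ3» FROM THE PER-MEMBER COMPOSER TEXT `hMemberL` (constants per `L`; `a Cr ε₁`, `PlaqSmall ε₁ V` kept).**
See the module docstring.  Choices: `Rₚ := 2`, `B₁ := (2985·L·B₀+405)·X`, `Cρ := Cw·X³`, `qρ := 3`, `X := M+L+S+M′+1`; per `ρ`: `Bsz := B₁·(ρ+1)³`.
[cite: Balaban1985RegularSpaces, Thm 2 p.83, (1.33)-(1.38) p.82; Balaban1985Variational, (144) p.300, (150)-(156) pp.301-302] -/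
theorem hSupUρ3_of_memberRowsL
    (hMemberL : ∀ L : ℕ, Odd L → 1 < L → ∃ (M' : ℕ) (_ : 1 ≤ M') (B₀ : ℝ) (_ : 0 ≤ B₀) (Cw : ℝ) (_ : 0 < Cw) (Mₚ : ℕ),
      ∀ (ρ S M : ℕ) (hM : 1 ≤ M), Mₚ ≤ M → 2 ≤ S → ∀ (a Cr : ℝ), 0 < Cr → 12 * ((ρ : ℝ) + (M : ℝ)) * a ≤ Cr →
      ∀ (ε₀ ε₁ : ℝ), 0 < ε₁ → 0 < ε₀ → ε₀ ≤ a → Cr * ε₁ ≤ ε₀ →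
      Cw * ((((ρ + M + L + S : ℕ) : ℝ) + (M' : ℝ) + 1) ^ 3 * ε₀) ≤ 1 →
      ∀ (Bsz : ℝ), (2985 * (L : ℝ) * B₀ + 405) * ((((ρ + M + L + S : ℕ) : ℝ) + (M' : ℝ) + 1)) ≤ Bsz →
      ∀ F : T3Family, F.L = L → ∀ (n K : ℕ) (hnK : n < K), 2 * ρ + (M' + 1 + 2 * (M + L + S)) ≤ F.L ^ (F.m + n) →
        ∀ V : GaugeField (F.P n) 0 (Matrix.specialUnitaryGroup (Fin 2) ℂ), PlaqSmall ε₁ V →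
          ∀ U ∈ regFibrePr F n K hnK.le ε₀ V, ∀ x₀ : Site (F.P K) 0,
              ∃ (t : ℤ) (_ : 0 ≤ t) (_ : t ≤ (M' : ℤ) - 1)
                (gJ : GaugeTransf (F.P K) 0 (Matrix.specialUnitaryGroup (Fin 2) ℂ))
                (u₁ : LSite (F.P K).d → (Matrix (Fin 2) (Fin 2) ℂ)ˣ)
                (W : LSite (F.P K).d → Fin (F.P K).d → (Matrix (Fin 2) (Fin 2) ℂ)ˣ)
                (A : LSite (F.P K).d → Fin (F.P K).d → Matrix (Fin 2) (Fin 2) ℂ)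
                (c₁ c' : ℝ)
                (κf : (Site (F.P K) 0 → Matrix (Fin 2) (Fin 2) ℂ) → (i : ℕ) → GaugeTransf (F.P K) i (Matrix (Fin 2) (Fin 2) ℂ)ˣ)
                (lam : LSite (F.P K).d → Matrix (Fin 2) (Fin 2) ℂ)
                (α₄ cA : ℝ),
                -- hu₁SU
                (∀ z, ((u₁ z : (Matrix (Fin 2) (Fin 2) ℂ)ˣ) : Matrix (Fin 2) (Fin 2) ℂ) ∈ Matrix.specialUnitaryGroup (Fin 2) ℂ) ∧
                -- hW
                (mgauge (1 : LSite (F.P K).d → Fin (F.P K).d → (Matrix (Fin 2) (Fin 2) ℂ)ˣ) u₁ W = pull (unitsField (toUField (GaugeField.gaugeAct gJ U))) 0) ∧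
                -- hchart₀
                (∀ b ∈ {b : LSite (F.P K).d × Fin (F.P K).d | SideTouches (cubeFam false (F.P K).L (fun μ => ((iterBlockOf (K - n) x₀ μ).val : ℤ) - t) M' (ρ + M + L + S) (K - n) 0) b.1 b.2},
      W b.1 b.2 = cfgExp (((F.L : ℝ)⁻¹) ^ (K - n)) A b.1 b.2) ∧
                -- hc'
                (0 ≤ c') ∧
                -- hbudget
                (8 * 3800 * ((((F.P K).d + 2) * (F.P K).L : ℕ) : ℝ) ^ 2 * c' ≤ 1) ∧
                -- hc₁
                (Real.exp c₁ - 1 ≤ ((F.L : ℝ)⁻¹) ^ (K - n) * c') ∧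
                -- hchartTop
                (∀ z ∈ cube (F.P K).L (fun μ => ((iterBlockOf (K - n) x₀ μ).val : ℤ) - t) M' (ρ + M + L + S) (K - n) (K - n), ∀ ν : Fin (F.P K).d,
      W z ν = cfgExp (((F.L : ℝ)⁻¹) ^ (K - n)) A z ν ∧ ((F.L : ℝ)⁻¹) ^ (K - n) * ‖A z ν‖ ≤ c₁) ∧
                -- hκfs
                (∀ (m : Site (F.P K) 0 → Matrix (Fin 2) (Fin 2) ℂ) (i : ℕ) (y : Site (F.P K) (i + 1)),
      κf m (i + 1) y = (vframeU (gaugeActT (κf m i) (dbarIterU i (gaugeActT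
        (fun s => (u₁ (lift (F.P K) x₀ + rel x₀ s))⁻¹ * Unitary.toUnits (suIncl (gJ s)) : GaugeTransf (F.P K) 0 (Matrix (Fin 2) (Fin 2) ℂ)ˣ)
        (unitsField (toUField U))))) y)⁻¹ * κf m i (emb y) *
        vframeU (dbarIterU i (gaugeActT
          (fun s => (u₁ (lift (F.P K) x₀ + rel x₀ s))⁻¹ * Unitary.toUnits (suIncl (gJ s)) : GaugeTransf (F.P K) 0 (Matrix (Fin 2) (Fin 2) ℂ)ˣ)
          (unitsField (toUField U)))) y) ∧
                -- hκf0
                (∀ (m : Site (F.P K) 0 → Matrix (Fin 2) (Fin 2) ℂ) (x : Site (F.P K) 0), ((κf m 0 x : (Matrix (Fin 2) (Fin 2) ℂ)ˣ) : Matrix (Fin 2) (Fin 2) ℂ) = exp (m x)) ∧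
                -- hα0
                (0 ≤ α₄) ∧
                -- hα
                (α₄ ≤ 1 / 70) ∧
                -- hcA0
                (0 ≤ cA) ∧
                -- hcA
                (cA ≤ 1 / 12) ∧
                -- hsa
                (∀ x, IsSelfAdjoint (lam x)) ∧
                -- htr
                (∀ x, (lam x).trace = 0) ∧
                -- hsupp
                (∀ x, x ∉ cubeFam false (F.P K).L (fun μ => ((iterBlockOf (K - n) x₀ μ).val : ℤ) - t) M' (ρ + M + L + S) (K - n) 0 → lam x = 0) ∧
                -- h108₀
                (∀ b ∈ {b : LSite (F.P K).d × Fin (F.P K).d | SideTouches (cubeFam false (F.P K).L (fun μ => ((iterBlockOf (K - n) x₀ μ).val : ℤ) - t) M' (ρ + M + L + S) (K - n) 0) b.1 b.2},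
      ‖lam b.1‖ ≤ α₄ ∧ wt (F.P K).L (((F.L : ℝ)⁻¹) ^ (K - n)) 0 *
        ‖covDerivFwd (((F.L : ℝ)⁻¹) ^ (K - n)) (1 : LSite (F.P K).d → Fin (F.P K).d → (Matrix (Fin 2) (Fin 2) ℂ)ˣ) b.2 lam b.1‖ ≤ α₄) ∧
                -- hmult
                (∃ μ : ℕ → LSite (F.P K).d → Matrix (Fin 2) (Fin 2) ℂ, ∀ x ∈ cubeFam false (F.P K).L (fun μ => ((iterBlockOf (K - n) x₀ μ).val : ℤ) - t) M' (ρ + M + L + S) (K - n) 0,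
      covLap (((F.L : ℝ)⁻¹) ^ (K - n)) (1 : LSite (F.P K).d → Fin (F.P K).d → (Matrix (Fin 2) (Fin 2) ℂ)ˣ)
        ((cubeFam false (F.P K).L (fun μ => ((iterBlockOf (K - n) x₀ μ).val : ℤ) - t) M' (ρ + M + L + S) (K - n) 0).indicator fun y =>
          covDivB (((F.L : ℝ)⁻¹) ^ (K - n)) (1 : LSite (F.P K).d → Fin (F.P K).d → (Matrix (Fin 2) (Fin 2) ℂ)ˣ) A y +
          covLap (((F.L : ℝ)⁻¹) ^ (K - n)) (1 : LSite (F.P K).d → Fin (F.P K).d → (Matrix (Fin 2) (Fin 2) ℂ)ˣ) lam y +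
          ((conjR (gaugeExp lam y)⁻¹ (covDivB (((F.L : ℝ)⁻¹) ^ (K - n)) (1 : LSite (F.P K).d → Fin (F.P K).d → (Matrix (Fin 2) (Fin 2) ℂ)ˣ) A y) -
              covDivB (((F.L : ℝ)⁻¹) ^ (K - n)) (1 : LSite (F.P K).d → Fin (F.P K).d → (Matrix (Fin 2) (Fin 2) ℂ)ˣ) A y) +
            (gAd (covLap (((F.L : ℝ)⁻¹) ^ (K - n)) (1 : LSite (F.P K).d → Fin (F.P K).d → (Matrix (Fin 2) (Fin 2) ℂ)ˣ) lam y) (lam y) -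
              covLap (((F.L : ℝ)⁻¹) ^ (K - n)) (1 : LSite (F.P K).d → Fin (F.P K).d → (Matrix (Fin 2) (Fin 2) ℂ)ˣ) lam y) +
            ∑ μ, frakF3 (((F.L : ℝ)⁻¹) ^ (K - n)) (1 : LSite (F.P K).d → Fin (F.P K).d → (Matrix (Fin 2) (Fin 2) ℂ)ˣ) lam A y μ)) x =
        QT (F.P K).L (K - n) (cubeLamS (F.P K).L (fun μ => ((iterBlockOf (K - n) x₀ μ).val : ℤ) - t) M' (ρ + M + L + S) (K - n) (K - n)) (1 : LSite (F.P K).d → Fin (F.P K).d → (Matrix (Fin 2) (Fin 2) ℂ)ˣ) μ x) ∧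
                -- htopId
                (∀ yc ∈ cubeLamS (F.P K).L (fun μ => ((iterBlockOf (K - n) x₀ μ).val : ℤ) - t) M' (ρ + M + L + S) (K - n) (K - n) (K - n),
      κf (((-I) • lam) ∘ fun s : Site (F.P K) 0 => lift (F.P K) x₀ + rel x₀ s) (K - n) (coverAt (F.P K) (K - n) yc) =
        axialT (dbarIterU (K - n) (gaugeActT
          (fun s => (u₁ (lift (F.P K) x₀ + rel x₀ s))⁻¹ * Unitary.toUnits (suIncl (gJ s)) : GaugeTransf (F.P K) 0 (Matrix (Fin 2) (Fin 2) ℂ)ˣ)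
          (unitsField (toUField U)))) (iterBlockOf (K - n) x₀) (coverAt (F.P K) (K - n) yc)) ∧
                -- hA0
                (∀ x ∈ cubeFam false (F.P K).L (fun μ => ((iterBlockOf (K - n) x₀ μ).val : ℤ) - t) M' (ρ + M + L + S) (K - n) 0, ∀ μ : Fin (F.P K).d,
      wt (F.P K).L (((F.L : ℝ)⁻¹) ^ (K - n)) 0 * ‖A x μ‖ ≤ cA ∧
        wt (F.P K).L (((F.L : ℝ)⁻¹) ^ (K - n)) 0 *
          ‖conjR ((1 : LSite (F.P K).d → Fin (F.P K).d → (Matrix (Fin 2) (Fin 2) ℂ)ˣ) (x - e μ) μ)⁻¹ (A (x - e μ) μ)‖ ≤ cA) ∧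
                -- hX1
                (∀ j, j ≤ K - n → ∀ z ∈ cube (F.P K).L (fun μ => ((iterBlockOf (K - n) x₀ μ).val : ℤ) - t) M' (ρ + M + L + S) (K - n) j, ∀ ν' : Fin (F.P K).d,
      (F.L : ℝ) ^ j * ((F.L : ℝ)⁻¹) ^ (K - n) *
        ‖logCfg (((F.L : ℝ)⁻¹) ^ (K - n)) (mgauge (1 : LSite (F.P K).d → Fin (F.P K).d → (Matrix (Fin 2) (Fin 2) ℂ)ˣ) (gaugeExp lam)⁻¹
          (cfgExp (((F.L : ℝ)⁻¹) ^ (K - n)) A)) z ν'‖ ≤ Bsz * ε₀) ∧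
                -- hX2
                (∀ j, j ≤ K - n → ∀ z ∈ cube (F.P K).L (fun μ => ((iterBlockOf (K - n) x₀ μ).val : ℤ) - t) M' (ρ + M + L + S) (K - n) j, ∀ ν' μ' : Fin (F.P K).d,
      z + e μ' ∈ cube (F.P K).L (fun μ => ((iterBlockOf (K - n) x₀ μ).val : ℤ) - t) M' (ρ + M + L + S) (K - n) 0 →
      ((F.L : ℝ) ^ j * ((F.L : ℝ)⁻¹) ^ (K - n)) ^ 2 * (F.L : ℝ) ^ (K - n) *
        ‖logCfg (((F.L : ℝ)⁻¹) ^ (K - n)) (mgauge (1 : LSite (F.P K).d → Fin (F.P K).d → (Matrix (Fin 2) (Fin 2) ℂ)ˣ) (gaugeExp lam)⁻¹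
            (cfgExp (((F.L : ℝ)⁻¹) ^ (K - n)) A)) (z + e μ') ν' -
          logCfg (((F.L : ℝ)⁻¹) ^ (K - n)) (mgauge (1 : LSite (F.P K).d → Fin (F.P K).d → (Matrix (Fin 2) (Fin 2) ℂ)ˣ) (gaugeExp lam)⁻¹
            (cfgExp (((F.L : ℝ)⁻¹) ^ (K - n)) A)) z ν'‖ ≤ Bsz * ε₀)) :
    ∀ L : ℕ, Odd L → 1 < L → ∃ (Mₚ Rₚ : ℕ), ∀ (R M aₑ S : ℕ) (hM : 1 ≤ M), M = L ^ aₑ → Mₚ ≤ M → Rₚ ≤ R → R * M ≤ S →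
      ∃ B₁ : ℝ, 0 ≤ B₁ ∧ ∃ M' : ℕ, 1 ≤ M' ∧ ∃ Cρ : ℝ, 0 < Cρ ∧ ∃ qρ : ℕ,
      ∀ (ρ : ℕ) (a Cr : ℝ), 0 < Cr → 12 * ((ρ : ℝ) + (M : ℝ)) * a ≤ Cr →
        16 * 3800 * ((5 * L : ℕ) : ℝ) ^ 2 * (L : ℝ) * ((B₁ * ((ρ : ℝ) + 1) ^ qρ + 1) * a) ≤ 1 → Cρ * ((ρ : ℝ) + 1) ^ qρ * a ≤ 1 →
        ∀ F : T3Family, F.L = L → ∀ (n K : ℕ) (hnK : n < K), 2 * ρ + (M' + 1 + 2 * (M + L + S)) ≤ F.L ^ (F.m + n) →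
          ∀ (ε₀ ε₁ : ℝ), 0 < ε₁ → 0 < ε₀ → ε₀ ≤ a → Cr * ε₁ ≤ ε₀ →
          ∀ V : GaugeField (F.P n) 0 (Matrix.specialUnitaryGroup (Fin 2) ℂ), PlaqSmall ε₁ V →
            ∀ U ∈ regFibrePr F n K hnK.le ε₀ V, ∀ x₀ : Site (F.P K) 0,
              ∃ (t : ℤ) (_ : 0 ≤ t) (_ : t ≤ (M' : ℤ) - 1)
                (w : LSite (F.P K).d → Matrix.specialUnitaryGroup (Fin 2) ℂ) (X : LSite (F.P K).d → Fin (F.P K).d → Matrix (Fin 2) (Fin 2) ℂ)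
                (μ : ℕ → LSite (F.P K).d → Matrix (Fin 2) (Fin 2) ℂ)
                (g h' : GaugeTransf (F.P K) 0 (Matrix (Fin 2) (Fin 2) ℂ)ˣ) (κ' : (i : ℕ) → GaugeTransf (F.P K) i (Matrix (Fin 2) (Fin 2) ℂ)ˣ)
                (ν : (i : ℕ) → Site (F.P K) i → (Matrix (Fin 2) (Fin 2) ℂ)ˣ) (gs' : (i : ℕ) → GaugeTransf (F.P K) i (Matrix (Fin 2) (Fin 2) ℂ)ˣ),
                -- [N05 ∕ J3] chart rows and flat Landau window at the corner `a := Bᵏx₀ − t`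
                (∀ z ∈ cube (F.P K).L (fun μ => ((iterBlockOf (K - n) x₀ μ).val : ℤ) - t) M' (ρ + M + L + S) (K - n) 0, ∀ ν : Fin (F.P K).d,
                  transl (0 : Site (F.P K) 0) z ∈ cubeSetM x₀ (K - n) ρ S M 0 → (transl (0 : Site (F.P K) 0) z).shift ν ∈ cubeSetM x₀ (K - n) ρ S M 0 →
                  ‖(((Unitary.toUnits (suIncl (w z)))⁻¹ * unitsField (toUField U) ⟨transl 0 z, ν⟩ * Unitary.toUnits (suIncl (w (z + e ν))) :
                      (Matrix (Fin 2) (Fin 2) ℂ)ˣ) : Matrix (Fin 2) (Fin 2) ℂ) - 1‖ ≤ 1 / 4) ∧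
                (∀ z ∈ cube (F.P K).L (fun μ => ((iterBlockOf (K - n) x₀ μ).val : ℤ) - t) M' (ρ + M + L + S) (K - n) 0, ∀ ν : Fin (F.P K).d,
                  transl (0 : Site (F.P K) 0) z ∈ cubeSetM x₀ (K - n) ρ S M 0 → (transl (0 : Site (F.P K) 0) z).shift ν ∈ cubeSetM x₀ (K - n) ρ S M 0 →
                  I • ((((F.L : ℝ)⁻¹) ^ (K - n)) • X z ν) = mlog (((Unitary.toUnits (suIncl (w z)))⁻¹ * unitsField (toUField U) ⟨transl 0 z, ν⟩ *
                      Unitary.toUnits (suIncl (w (z + e ν))) : (Matrix (Fin 2) (Fin 2) ℂ)ˣ) : Matrix (Fin 2) (Fin 2) ℂ)) ∧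
                (∀ z ∈ cube (F.P K).L (fun μ => ((iterBlockOf (K - n) x₀ μ).val : ℤ) - t) M' (ρ + M + L + S) (K - n) 0,
                  covLap (((F.L : ℝ)⁻¹) ^ (K - n)) (1 : LSite (F.P K).d → Fin (F.P K).d → (Matrix (Fin 2) (Fin 2) ℂ)ˣ)
                      ((cube (F.P K).L (fun μ => ((iterBlockOf (K - n) x₀ μ).val : ℤ) - t) M' (ρ + M + L + S) (K - n) 0).indicator
                        (covDivB (((F.L : ℝ)⁻¹) ^ (K - n)) (1 : LSite (F.P K).d → Fin (F.P K).d → (Matrix (Fin 2) (Fin 2) ℂ)ˣ) X)) z =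
                    QT (F.P K).L (K - n) (cubeLamS (F.P K).L (fun μ => ((iterBlockOf (K - n) x₀ μ).val : ℤ) - t) M' (ρ + M + L + S) (K - n) (K - n))
                      (1 : LSite (F.P K).d → Fin (F.P K).d → (Matrix (Fin 2) (Fin 2) ℂ)ˣ) μ z) ∧
                -- [top step] frames, composite gauge, top identity
                κ' 0 = h' ∧
                (∀ (i : ℕ) (y : Site (F.P K) (i + 1)),
                  κ' (i + 1) y = (vframeU (gaugeActT (κ' i) (dbarIterU i (gaugeActT g (unitsField (toUField U))))) y)⁻¹ * κ' i (emb y) *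
                    vframeU (dbarIterU i (gaugeActT g (unitsField (toUField U)))) y) ∧
                (∀ s, ν 0 s = 1) ∧
                (∀ (i : ℕ) (y : Site (F.P K) (i + 1)), ν (i + 1) y = ν i (emb y) * vframeU (dbarIterU i (gaugeActT g (unitsField (toUField U)))) y) ∧
                gs' 0 = g ∧ (∀ (i : ℕ) (y : Site (F.P K) (i + 1)), gs' (i + 1) y = gs' i (emb y)) ∧
                (∀ s, (Unitary.toUnits (suIncl (w (lift (F.P K) x₀ + rel x₀ s))))⁻¹ =
                  ((gs' (K - n) (iterBlockOf (K - n) x₀))⁻¹ * ν (K - n) (iterBlockOf (K - n) x₀)) * h' s * g s) ∧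
                (∀ yc ∈ cubeLamS (F.P K).L (fun μ => ((iterBlockOf (K - n) x₀ μ).val : ℤ) - t) M' (ρ + M + L + S) (K - n) (K - n) (K - n),
                  κ' (K - n) (coverAt (F.P K) (K - n) yc) =
                    axialT (dbarIterU (K - n) (gaugeActT g (unitsField (toUField U)))) (iterBlockOf (K - n) x₀) (coverAt (F.P K) (K - n) yc)) ∧
                -- [sizes] the two (1.36)♭ rows of `A := X ∘ rep`
                (∀ wt : ℕ → PBond (F.P K) 0 → ℝ, IsLevWeight F n K (cubeSeqMT3 F n K x₀ ρ S M hM) wt →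
                  (∀ b : PBond (F.P K) 0, wt 1 b *
                    ‖(fun b : PBond (F.P K) 0 => if b.src ∈ cubeSetM x₀ (K - n) ρ S M 0 ∧ b.tgt ∈ cubeSetM x₀ (K - n) ρ S M 0 then
                      X (lift (F.P K) x₀ + rel x₀ b.src) b.dir else 0) b‖ ≤ B₁ * ((ρ : ℝ) + 1) ^ qρ * ε₀) ∧
                  (∀ (b : PBond (F.P K) 0) (ν' : Fin (F.P K).d), wt 2 b * (F.L : ℝ) ^ (K - n) *
                    ‖(fun b : PBond (F.P K) 0 => if b.src ∈ cubeSetM x₀ (K - n) ρ S M 0 ∧ b.tgt ∈ cubeSetM x₀ (K - n) ρ S M 0 then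
                        X (lift (F.P K) x₀ + rel x₀ b.src) b.dir else 0) ⟨b.src.shift ν', b.dir⟩ -
                      (fun b : PBond (F.P K) 0 => if b.src ∈ cubeSetM x₀ (K - n) ρ S M 0 ∧ b.tgt ∈ cubeSetM x₀ (K - n) ρ S M 0 then
                        X (lift (F.P K) x₀ + rel x₀ b.src) b.dir else 0) b‖ ≤ B₁ * ((ρ : ℝ) + 1) ^ qρ * ε₀)) := by
  refine hSupUρ3_of_siteRows ?_
  intro L hodd hL
  obtain ⟨M', hM', B₀, hB₀, Cw, hCw, Mₚ, hMember⟩ := hMemberL L hodd hL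
  refine ⟨Mₚ, 2, fun R M aₑ S hM hMe hMₚ hRₚ hRS => ?_⟩
  have hS : 2 ≤ S := by
    have h2R : 2 ≤ R := hRₚ
    have : R * 1 ≤ R * M := Nat.mul_le_mul_left R hM
    omega
  -- the ρ-free constants of the display
  set X : ℝ := (M : ℝ) + (L : ℝ) + (S : ℝ) + (M' : ℝ) + 1 with hX
  have hX1 : 1 ≤ X := by
    have : (0 : ℝ) ≤ (M : ℝ) + (L : ℝ) + (S : ℝ) + (M' : ℝ) := by positivity
    linarith only [this, hX]
  have hX0 : 0 ≤ X := by linarith only [hX1]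
  have hB₁0 : 0 ≤ (2985 * (L : ℝ) * B₀ + 405) * X := by positivity
  refine ⟨(2985 * (L : ℝ) * B₀ + 405) * X, hB₁0, M', hM', Cw * X ^ 3, by positivity, 3,
    fun ρ a Cr hCr hreg₁ hreg₀ hregρ F hF n K hnK hroom ε₀ ε₁ hε₁ hε₀ hε₀a hCrε V hV U hU x₀ => ?_⟩
  -- `ρ′ + M′ + 1 ≤ (ρ+1)·X`
  have hρ0 : (0 : ℝ) ≤ (ρ : ℝ) := Nat.cast_nonneg ρ
  have hcast : (((ρ + M + L + S : ℕ) : ℝ) + (M' : ℝ) + 1) = (ρ : ℝ) + X := by push_cast; rw [hX]; ring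
  have hkey : (ρ : ℝ) + X ≤ ((ρ : ℝ) + 1) * X := by nlinarith only [hρ0, hX1]
  have hn0 : 0 ≤ (ρ : ℝ) + X := by linarith only [hρ0, hX0]
  -- the window smallness from the ρ-window `Cρ(ρ+1)³a ≤ 1` and `ε₀ ≤ a`
  have hw : Cw * ((((ρ + M + L + S : ℕ) : ℝ) + (M' : ℝ) + 1) ^ 3 * ε₀) ≤ 1 := by
    rw [hcast]
    have h1 : ((ρ : ℝ) + X) ^ 3 ≤ (((ρ : ℝ) + 1) * X) ^ 3 := pow_le_pow_left₀ hn0 hkey 3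
    have h2 : ((ρ : ℝ) + X) ^ 3 * ε₀ ≤ (((ρ : ℝ) + 1) * X) ^ 3 * a :=
      mul_le_mul h1 hε₀a hε₀.le (by positivity)
    calc Cw * (((ρ : ℝ) + X) ^ 3 * ε₀) ≤ Cw * ((((ρ : ℝ) + 1) * X) ^ 3 * a) := mul_le_mul_of_nonneg_left h2 hCw.le
      _ = Cw * X ^ 3 * ((ρ : ℝ) + 1) ^ 3 * a := by ring
      _ ≤ 1 := hregρ
  -- the size letter `Bsz := B₁(ρ+1)³`
  have hρ1 : (1 : ℝ) ≤ (ρ : ℝ) + 1 := by linarith only [hρ0]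
  have hBsz : (2985 * (L : ℝ) * B₀ + 405) * ((((ρ + M + L + S : ℕ) : ℝ) + (M' : ℝ) + 1)) ≤
      (2985 * (L : ℝ) * B₀ + 405) * X * ((ρ : ℝ) + 1) ^ 3 := by
    rw [hcast]
    have h3 : ((ρ : ℝ) + 1) * X ≤ X * ((ρ : ℝ) + 1) ^ 3 := by
      have hp : (ρ : ℝ) + 1 ≤ ((ρ : ℝ) + 1) ^ 3 := by
        calc (ρ : ℝ) + 1 = ((ρ : ℝ) + 1) ^ 1 := (pow_one _).symm
          _ ≤ ((ρ : ℝ) + 1) ^ 3 := pow_le_pow_right₀ hρ1 (by norm_num)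
      calc ((ρ : ℝ) + 1) * X = X * ((ρ : ℝ) + 1) := mul_comm _ _
        _ ≤ X * ((ρ : ℝ) + 1) ^ 3 := mul_le_mul_of_nonneg_left hp hX0
    have h4 : (ρ : ℝ) + X ≤ X * ((ρ : ℝ) + 1) ^ 3 := hkey.trans h3
    have h5 : 0 ≤ 2985 * (L : ℝ) * B₀ + 405 := by positivity
    calc (2985 * (L : ℝ) * B₀ + 405) * ((ρ : ℝ) + X) ≤ (2985 * (L : ℝ) * B₀ + 405) * (X * ((ρ : ℝ) + 1) ^ 3) :=
          mul_le_mul_of_nonneg_left h4 h5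
      _ = (2985 * (L : ℝ) * B₀ + 405) * X * ((ρ : ℝ) + 1) ^ 3 := by ring
  exact hMember ρ S M hM hMₚ hS a Cr hCr hreg₁ ε₀ ε₁ hε₁ hε₀ hε₀a hCrε hw ((2985 * (L : ℝ) * B₀ + 405) * X * ((ρ : ℝ) + 1) ^ 3) hBsz
    F hF n K hnK hroom V hV U hU x₀

end Summit.QuantumFields.YangMills.Theorems.HalvingHSupURho3OfMemberRowsL

end
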